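import Literature.Analysis.FluidPDE.SawtoothCascadeK2Classical

/-!
# Sketch — K2 control norm («bellman-weight»), F-p4g14-1 (planner ad-ideate-p4 g14, lens `control`)

Bears on the route-2 K2 crux of record (arbiter A25-9, SHAPE Q v2)
`K2GrowthCtgPointH := ∃ δ₀ ∈ Ioc 0 2⁻¹⁰⁰, K2PhaseGrowthClassicalH ⟨8, δ₀, 2, 1, 2⟩ 5` (filed today as
`stmt-AnomalousDissipation-19696`, older family form).  Memo: `K2ControlNorm.md` (same crux dir).

Typed here (all `def … : Prop`, no `sorry`, no instances, no notation):
* `PhaseBudget` — S1, the PHASE BUDGET LEMMA: for every lattice class `(α,β) ∈ [0,½]²` the modal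
  Kelvin–Helmholtz rates of the two slots of a phase add up to at most `σ⋆`
  (`σ_H(α,β) + σ_V(α,β) ≤ sawSigmaStar`).  CERTIFIED by ball arithmetic (kit j319236, 375 boxes + strips);
  numerically `max = 0.3098168` at `(0, 0.4888)` (one slot inert), `≤ 0.2122` when both slots are active.
* `BothActiveSmall` — the cheap sufficient 2-D piece (`both active ⇒ Σ ≤ 0.22`), and the PROVED reduction
  `phaseBudget_of_bothActiveSmall` (with the tree's 1-D bound `sawSigma_le_sawSigmaStar`).
* `KHSheetLyapunov γ κ` / `KHSheetAbsolute γ B` — S2, the 2×2 Kelvin–Helmholtz sheet block of a line `k`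
  with Bloch phase `β` in the ENERGY Gram `M = −[[Σ₀,S],[S̄,Σ₀]]` (tree's `sawSigma0`, `sawS`), as a
  quadratic-form Lyapunov statement for solutions of `q′ = X q`, `X = ik·[[−(π/2+2Σ₀), −2S],[2S̄, π/2+2Σ₀]]`
  (Re-eigenvalues `±σ(k,β)`); numerics at γ = 8: `κ_sup = 7.05` (long waves), `B = 13.62 = 1.142·e^{8σ⋆}`.
* `CombPrepay γ B` — N3, the Bellman pre-payment of comb content: along every sharp-cascade cotangent
  itinerary started on an axis, `|k|²` never returns below an earlier slot-end value by more than the factor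
  `B` (numerically `sup = 32 − 8√15 = 1.01613` at γ = 8, alternating cell signs; generic tilted data: `1+γ² = 65`).
* `weightedCocycle_energy_bound` — PROVED: the abstract bookkeeping of the line (a time-dependent norm `N_j`
  with `E ≤ N_j`, `N_{j+1} ∘ Φ_j ≤ Λ² N_j`, `N_{j₀} ≤ C₀ E` on the datum gives `E ≤ C₀ Λ^{2m} E₀` after `m` phases).

* §6 (v3, F-p4g15-1, g15) — MATERIAL STRUCTURE: the dual (conormal) cocycle `R M Rᵀ = M⁻ᵀ` (`transpose_mul_rot_conj`,
  `itinJac_transpose_mul_dual`), cone avoidance in material form (`dual_cone_growth`, from `itinJac_growth_two`), and the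
  weighted two-component slot step / two-slot composition of the material budget (`twoComponent_step`, `twoSlot_phase`).

Nothing here is asserted as a theorem about K2; the Props are stub signatures for a crux-plan seat.
-/

open Set

namespace Summit.AnomalousDissipation.AnomalousDissipation.Cruxes.K1LocalisedCascade.K2Control

open Literature.Analysis.FluidPDE.SawtoothCascade

noncomputable section

/-! ## S1 — the phase budget lemma -/

/-- Modal rate of the H slot for the lattice class `(α,β)`: only the lines `k₁ ∈ {α, 1−α}` can lie in the
Kelvin–Helmholtz band (`a_c = 0.7637…`), the `y`-Bloch phase is `β`. -/
def sigmaH (α β : ℝ) : ℝ := max (sawSigma α β) (sawSigma (1 - α) β)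

/-- Modal rate of the V slot for the class `(α,β)`: lines `k₂ ∈ {β, 1−β}`, `x`-Bloch phase `α`. -/
def sigmaV (α β : ℝ) : ℝ := max (sawSigma β α) (sawSigma (1 - β) α)

/-- **S1. PHASE BUDGET LEMMA.**  For every class the modal rates of the two slots of a phase sum to at most
`σ⋆ = 0.30982`: one Kelvin–Helmholtz e-folding set `e^{γσ⋆}` per PHASE, class-free.  Certified by ball
arithmetic (kit j319236: branch-and-bound on `[1/64,½]²`, strips by elementary lemmas); Lean port = stub. -/
def PhaseBudget : Prop :=
  ∀ α ∈ Icc (0 : ℝ) (1 / 2), ∀ β ∈ Icc (0 : ℝ) (1 / 2), sigmaH α β + sigmaV α β ≤ sawSigmaStar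

/-- The 2-D piece with margin: when BOTH slots are active the sum is small (numerically `≤ 0.2122`,
attained near `(0.354, 0.354)`; both-active classes lie in `[0.2838, 0.4831]²`). -/
def BothActiveSmall : Prop :=
  ∀ α ∈ Icc (0 : ℝ) (1 / 2), ∀ β ∈ Icc (0 : ℝ) (1 / 2),
    0 < sigmaH α β → 0 < sigmaV α β → sigmaH α β + sigmaV α β ≤ 0.22

theorem sawSigma_nonneg {k : ℝ} (hk : 0 ≤ k) (β : ℝ) : 0 ≤ sawSigma k β :=
  mul_nonneg hk (Real.sqrt_nonneg _)

theorem sigmaH_nonneg {α : ℝ} (hα : α ∈ Icc (0 : ℝ) (1 / 2)) (β : ℝ) : 0 ≤ sigmaH α β :=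
  le_max_of_le_left (sawSigma_nonneg hα.1 β)

theorem sigmaV_nonneg (α : ℝ) {β : ℝ} (hβ : β ∈ Icc (0 : ℝ) (1 / 2)) : 0 ≤ sigmaV α β :=
  le_max_of_le_left (sawSigma_nonneg hβ.1 α)

theorem sigmaH_le (α β : ℝ) : sigmaH α β ≤ sawSigmaStar :=
  max_le (sawSigma_le_sawSigmaStar _ _) (sawSigma_le_sawSigmaStar _ _)

theorem sigmaV_le (α β : ℝ) : sigmaV α β ≤ sawSigmaStar :=
  max_le (sawSigma_le_sawSigmaStar _ _) (sawSigma_le_sawSigmaStar _ _)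

/-- The reduction: the 2-D piece with margin plus the tree's 1-D bound give the phase budget lemma. -/
theorem phaseBudget_of_bothActiveSmall (h : BothActiveSmall) : PhaseBudget := by
  intro α hα β hβ
  rcases (sigmaH_nonneg hα β).eq_or_lt with h0 | hH
  · rw [← h0, zero_add]; exact sigmaV_le α β
  rcases (sigmaV_nonneg α hβ).eq_or_lt with h0 | hV
  · rw [← h0, add_zero]; exact sigmaH_le α β
  have h22 := h α hα β hβ hH hV
  have : (0.22 : ℝ) ≤ sawSigmaStar := by norm_num [sawSigmaStar]
  exact h22.trans this

/-! ## S2 — the Kelvin–Helmholtz sheet block in the energy Gram (no matrix exponential) -/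

/-- The generator of the 2×2 sheet block of the line `k` with Bloch phase `β` (strain time), tree units:
`X q = ik·(−(π/2+2Σ₀) q₀ − 2S q₁, 2S̄ q₀ + (π/2+2Σ₀) q₁)`; its eigenvalues are `±ik√(c²(k,β))`, i.e. real
`±σ(k,β)` exactly when `c² < 0`. -/
def khField (k β : ℝ) (q : Fin 2 → ℂ) : Fin 2 → ℂ :=
  let p : ℂ := ((Real.pi / 2 + 2 * sawSigma0 k β : ℝ) : ℂ)
  let S : ℂ := sawS k β
  ![Complex.I * (k : ℂ) * (-p * q 0 - 2 * S * q 1),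
    Complex.I * (k : ℂ) * (2 * (starRingEnd ℂ S) * q 0 + p * q 1)]

/-- Kinetic energy of the velocity induced by the sheet pair with amplitudes `q` (per cell, up to a positive
scalar): `qᴴ M q`, `M = −[[Σ₀, S],[S̄, Σ₀]]` (the Bloch Green's function at lag `0` and at half a period). -/
def khForm (k β : ℝ) (q : Fin 2 → ℂ) : ℝ :=
  -(sawSigma0 k β) * (Complex.normSq (q 0) + Complex.normSq (q 1))
    - 2 * ((starRingEnd ℂ (q 0)) * sawS k β * q 1).re

/-- **S2 (rate form).**  Energy-Gram Lyapunov bound of the sheet block with the modal rate and a non-normality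
constant `κ`: every solution of `q′ = X q` on `[0, γ]` obeys `qᴴMq(θ) ≤ κ² e^{2σ(k,β)θ} qᴴMq(0)`.
Numerically (γ = 8) `κ_sup = 7.05`, forced by LONG waves `k → 0, β = 0` (algebraic growth, σ → 0); in the
classes with `σ ≥ 0.2` the constant is `≤ 1.6`. -/
def KHSheetLyapunov (γ κ : ℝ) : Prop :=
  ∀ k β : ℝ, 0 < k → ∀ q : ℝ → (Fin 2 → ℂ),
    (∀ θ ∈ Icc (0 : ℝ) γ, HasDerivWithinAt q (khField k β (q θ)) (Icc (0 : ℝ) γ) θ) →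
    ∀ θ ∈ Icc (0 : ℝ) γ,
      khForm k β (q θ) ≤ κ ^ 2 * Real.exp (2 * sawSigma k β * θ) * khForm k β (q 0)

/-- **S2 (absolute form, the one the per-phase budget consumes).**  `qᴴMq(θ) ≤ B² qᴴMq(0)` on `[0,γ]` for every
line and class; numerically `B(8) = 13.62 = 1.142·e^{8σ⋆}` (at `(k,β,θ) = (0.44, 0, 8)`). -/
def KHSheetAbsolute (γ B : ℝ) : Prop :=
  ∀ k β : ℝ, 0 < k → ∀ q : ℝ → (Fin 2 → ℂ),
    (∀ θ ∈ Icc (0 : ℝ) γ, HasDerivWithinAt q (khField k β (q θ)) (Icc (0 : ℝ) γ) θ) →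
    ∀ θ ∈ Icc (0 : ℝ) γ, khForm k β (q θ) ≤ B ^ 2 * khForm k β (q 0)

/-! ## N3 — the Bellman pre-payment of comb content (sharp cotangent dynamics) -/

/-- One slot of the sharp cascade acting on a wavevector: the H slot keeps `k₁` and shears `k₂` by the cell
sign `s ∈ {±1}` times the strain `θ`; the V slot keeps `k₂`. -/
def cotStep (H : Bool) (s θ : ℝ) (k : ℝ × ℝ) : ℝ × ℝ :=
  if H then (k.1, k.2 - s * k.1 * θ) else (k.1 - s * k.2 * θ, k.2)

/-- Full slots with cell signs `l`, orientations alternating from `st.1`; returns (next orientation, wavevector). -/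
def cotRun (γ : ℝ) (st : Bool × (ℝ × ℝ)) (l : List ℝ) : Bool × (ℝ × ℝ) :=
  l.foldl (fun st s => (!st.1, cotStep st.1 s γ st.2)) st

/-- `|k|²`. -/
def sqNorm (k : ℝ × ℝ) : ℝ := k.1 ^ 2 + k.2 ^ 2

/-- **N3. Comb pre-payment.**  For an axis start `k₀ ∈ {(1,0),(0,1)}`, any itinerary of full slots `l₁` then
`l₂` then a partial slot `(s, θ)`: `|k(end of l₁)|² ≤ B·|k(later point)|²` — the energy weight of comb-descendant
content never improves by more than `B` in the future, so the Bellman weight charges it `≤ B × energy`.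
Numerically `sup = 32 − 8√15 = 1.016133…` at `γ = 8` (alternating signs, limit ratio `4 − √15` of the two
components), `1.0718` at `γ = 4`; for a generic tilted start `(1, γ)` the same sup is `1 + γ² = 65`. -/
def CombPrepay (γ B : ℝ) : Prop :=
  ∀ (H : Bool) (k₀ : ℝ × ℝ), (k₀ = (1, 0) ∨ k₀ = (0, 1)) →
  ∀ (l₁ l₂ : List ℝ), (∀ s ∈ l₁ ++ l₂, s = 1 ∨ s = -1) →
  ∀ s : ℝ, (s = 1 ∨ s = -1) → ∀ θ ∈ Icc (0 : ℝ) γ,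
    sqNorm (cotRun γ (H, k₀) l₁).2 ≤
      B * sqNorm (cotStep (cotRun γ (cotRun γ (H, k₀) l₁) l₂).1 s θ (cotRun γ (cotRun γ (H, k₀) l₁) l₂).2)

/-! ## The bookkeeping of the line, PROVED -/

/-- Trajectory of the phase maps `Φ_j` from phase `j₀`: `traj 0 = x₀`, `traj (m+1) = Φ_{j₀+m} (traj m)`. -/
def traj {X : Type*} (Φ : ℕ → X → X) (j₀ : ℕ) (x₀ : X) : ℕ → X
  | 0 => x₀
  | m + 1 => Φ (j₀ + m) (traj Φ j₀ x₀ m)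

/-- **Weighted cocycle ⇒ energy bound.**  If a time-dependent control norm dominates energy (`E ≤ N_j`),
grows by at most `Λ²` per phase along the dynamics (`N_{j+1}(Φ_j x) ≤ Λ² N_j x`) and is pre-paid on the datum
(`N_{j₀} x₀ ≤ C₀ E x₀`), then after `m` phases `E ≤ C₀ Λ^{2m} E x₀` — the shape of `K2PhaseGrowthClassicalH`
with `Λ = C e^{σ⋆γ}` once `C₀ ≤ 1` is absorbed (for comb data `C₀ ≤ 1.0162`, `CombPrepay`). -/
theorem weightedCocycle_energy_bound {X : Type*} (E : X → ℝ) (N : ℕ → X → ℝ) (Φ : ℕ → X → X)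
    {Λ C₀ : ℝ} (hΛ : 0 ≤ Λ) (hEN : ∀ j x, E x ≤ N j x)
    (hstep : ∀ j x, N (j + 1) (Φ j x) ≤ Λ ^ 2 * N j x)
    (j₀ : ℕ) (x₀ : X) (hC₀ : N j₀ x₀ ≤ C₀ * E x₀) (m : ℕ) :
    E (traj Φ j₀ x₀ m) ≤ C₀ * Λ ^ (2 * m) * E x₀ := by
  have key : ∀ m : ℕ, N (j₀ + m) (traj Φ j₀ x₀ m) ≤ Λ ^ (2 * m) * N j₀ x₀ := by
    intro m
    induction m with
    | zero => simp [traj]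
    | succ m ih =>
      have h1 : N (j₀ + m + 1) (Φ (j₀ + m) (traj Φ j₀ x₀ m)) ≤ Λ ^ 2 * N (j₀ + m) (traj Φ j₀ x₀ m) :=
        hstep (j₀ + m) _
      have h2 : Λ ^ 2 * N (j₀ + m) (traj Φ j₀ x₀ m) ≤ Λ ^ 2 * (Λ ^ (2 * m) * N j₀ x₀) :=
        mul_le_mul_of_nonneg_left ih (sq_nonneg Λ)
      have h3 : Λ ^ 2 * (Λ ^ (2 * m) * N j₀ x₀) = Λ ^ (2 * (m + 1)) * N j₀ x₀ := by ring
      show N (j₀ + (m + 1)) (Φ (j₀ + m) (traj Φ j₀ x₀ m)) ≤ Λ ^ (2 * (m + 1)) * N j₀ x₀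
      rw [← add_assoc, ← h3]
      exact h1.trans h2
  have hpow : 0 ≤ Λ ^ (2 * m) := pow_nonneg hΛ _
  calc E (traj Φ j₀ x₀ m) ≤ N (j₀ + m) (traj Φ j₀ x₀ m) := hEN _ _
    _ ≤ Λ ^ (2 * m) * N j₀ x₀ := key m
    _ ≤ Λ ^ (2 * m) * (C₀ * E x₀) := mul_le_mul_of_nonneg_left hC₀ hpow
    _ = C₀ * Λ ^ (2 * m) * E x₀ := by ring

end

/-! ## §5 Kinematic no-go (addendum WO-p4-K2-1, §3): the contracting direction of the wave-vector dynamics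

Per phase the (sign-optimised, backward) wave-vector map is `[[1+γ², γ],[γ, 1]]`, trace `γ²+2`, determinant `1`; its larger
eigenvalue `orrRate γ` is the sustained per-phase AMPLITUDE gain of packets riding the contracting direction (energy = |ζ̂|²/|k|², |k|
divided by `orrRate γ` per phase). The two lemmas below record `γ² + 1 < orrRate γ` and hence that every cap admitted by the
PointGlue window (`C·e^{σ⋆γ} < γ² − 3`) lies strictly below the kinematic rate: no data-blind energy-equivalent bound proves K2. -/

/-- The per-phase contraction/expansion rate of the cascade's wave-vector dynamics: the larger root of `λ + λ⁻¹ = γ² + 2`. -/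
noncomputable def orrRate (γ : ℝ) : ℝ := ((γ ^ 2 + 2) + Real.sqrt ((γ ^ 2 + 2) ^ 2 - 4)) / 2

/-- An explicit integer trajectory at γ = 8 (addendum §0.1): `(65,528) ↦H (65,8) ↦V (1,8) ↦H (1,0)`, `|k|²: 283009 → 65 → 1`,
per-phase energy gains `283009/65 ≥ 4353 ≥ 65.9²` (the cap² is `59.62² = 3555`) and `65`. -/
theorem contracting_trajectory_eight :
    (528 : ℤ) - 8 * 65 = 8 ∧ (65 : ℤ) - 8 * 8 = 1 ∧ (8 : ℤ) - 8 * 1 = 0 ∧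
    (65 : ℤ) ^ 2 + 528 ^ 2 = 283009 ∧ (65 : ℤ) * 4353 ≤ 283009 ∧ (659 : ℤ) ^ 2 ≤ 4353 * 10 ^ 2 := by
  norm_num

/-- `γ² + 1 < orrRate γ` for `γ ≥ 1` (indeed `orrRate γ > (γ²+2) − 1` since `√((γ²+2)² − 4) > γ²`). -/
theorem sq_add_one_lt_orrRate {γ : ℝ} (hγ : 1 ≤ γ) : γ ^ 2 + 1 < orrRate γ := by
  unfold orrRate
  have hγ2 : 1 ≤ γ ^ 2 := by nlinarith
  have hin : (γ ^ 2) ^ 2 < (γ ^ 2 + 2) ^ 2 - 4 := by nlinarith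
  have hsq : γ ^ 2 < Real.sqrt ((γ ^ 2 + 2) ^ 2 - 4) := by
    have h0 : 0 ≤ γ ^ 2 := sq_nonneg γ
    calc γ ^ 2 = Real.sqrt ((γ ^ 2) ^ 2) := (Real.sqrt_sq h0).symm
      _ < Real.sqrt ((γ ^ 2 + 2) ^ 2 - 4) := Real.sqrt_lt_sqrt (sq_nonneg _) hin
  linarith

/-- KINEMATIC NO-GO, numerical form: any cap admitted by the glue window (`C e^{σ⋆γ} < γ² − 3`) is below the kinematic rate. -/
theorem cap_lt_orrRate {γ C : ℝ} (hγ : 1 ≤ γ) (hcap : C * Real.exp (sawSigmaStar * γ) < γ ^ 2 - 3) :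
    C * Real.exp (sawSigmaStar * γ) < orrRate γ := by
  have h := sq_add_one_lt_orrRate hγ
  linarith

/-! ## §6 Material structure (F-p4g15-1, planner ad-ideate-p4 g15): the dual cocycle and the budget algebra

The sharp linearised cascade response to comb data is a LAMINATION: the transported comb plus vortex SHEETS on the
material images of the kink lines (memo `K2MaterialControl.md`, §1).  A sheet's wave-vectors are its conormals; the
conormal of a material line evolves by the DUAL cocycle `M⁻ᵀ`.  For `2×2` matrices `M⁻ᵀ·det M = R M Rᵀ` with `R` the
quarter turn, so the dual cocycle is the tangent cocycle conjugated by `R`: conormals of lines whose tangents lie in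
the (rotated) unstable cone grow at the tree's rate `(γ²−3)^n` (`itinJac_growth_two`) — cone avoidance in material
form (memo §1 S-5; the census of memo §2 D shows that sheet COHERENCE, not Fourier-support avoidance, is what makes
transport passive — the lemma is the kinematic half of that statement).  The last lemmas are the weighted two-component
step and the strong/weak slot composition that turn per-slot transport / creation coefficients into a per-phase factor
(memo §3). -/

section MaterialDual

open scoped Matrix

/-- The quarter turn `R = [[0,−1],[1,0]]` (tangent ↦ normal of a plane curve). -/
def rot : Matrix (Fin 2) (Fin 2) ℝ := !![0, -1; 1, 0]

@[simp] theorem rot_00 : rot 0 0 = 0 := by simp [rot]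
@[simp] theorem rot_01 : rot 0 1 = -1 := by simp [rot]
@[simp] theorem rot_10 : rot 1 0 = 1 := by simp [rot]
@[simp] theorem rot_11 : rot 1 1 = 0 := by simp [rot]

theorem rot_transpose_mul_rot : rotᵀ * rot = 1 := by
  ext i j; fin_cases i <;> fin_cases j <;>
    simp [Matrix.mul_apply, Fin.sum_univ_two, Matrix.transpose_apply]

theorem rot_mulVec_zero (v : Fin 2 → ℝ) : (rot *ᵥ v) 0 = -v 1 := by
  simp [Matrix.mulVec, dotProduct, Fin.sum_univ_two]

theorem rot_mulVec_one (v : Fin 2 → ℝ) : (rot *ᵥ v) 1 = v 0 := by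
  simp [Matrix.mulVec, dotProduct, Fin.sum_univ_two]

/-- The conjugate `R M Rᵀ` entrywise: `[[M₁₁, −M₁₀],[−M₀₁, M₀₀]]` (the transposed adjugate). -/
theorem rot_conj_apply (M : Matrix (Fin 2) (Fin 2) ℝ) :
    (rot * M * rotᵀ) 0 0 = M 1 1 ∧ (rot * M * rotᵀ) 0 1 = -M 1 0 ∧
      (rot * M * rotᵀ) 1 0 = -M 0 1 ∧ (rot * M * rotᵀ) 1 1 = M 0 0 := by
  simp [Matrix.mul_apply, Fin.sum_univ_two, Matrix.transpose_apply]

/-- **Duality in `GL₂`: `Mᵀ · (R M Rᵀ) = det M · 1`.**  For `det M = 1` the conjugate `R M Rᵀ` IS the inverse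
transpose `M⁻ᵀ`, i.e. the cocycle acting on conormals (wave-vectors) when `M` acts on tangents (and vice versa). -/
theorem transpose_mul_rot_conj (M : Matrix (Fin 2) (Fin 2) ℝ) :
    Mᵀ * (rot * M * rotᵀ) = M.det • (1 : Matrix (Fin 2) (Fin 2) ℝ) := by
  obtain ⟨h00, h01, h10, h11⟩ := rot_conj_apply M
  ext i j; fin_cases i <;> fin_cases j <;>
    simp [Matrix.mul_apply, Fin.sum_univ_two, Matrix.transpose_apply, Matrix.det_fin_two, h00, h01, h10, h11] <;> ring

/-- The pulse-pair Jacobian is unimodular. -/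
theorem det_pulseJac (γ r s : ℝ) : (pulseJac γ r s).det = 1 := by
  simp [pulseJac, Matrix.det_fin_two]; ring

/-- Every itinerary cocycle is unimodular. -/
theorem det_itinJac (γ : ℝ) : ∀ L : List (ℝ × ℝ), (itinJac γ L).det = 1
  | [] => by simp [itinJac]
  | p :: L => by rw [itinJac, Matrix.det_mul, det_pulseJac, det_itinJac γ L, one_mul]

/-- Hence `(itinJac γ L)ᵀ · (R · itinJac γ L · Rᵀ) = 1`: the rotated cocycle is the dual (inverse-transpose) cocycle. -/
theorem itinJac_transpose_mul_dual (γ : ℝ) (L : List (ℝ × ℝ)) :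
    (itinJac γ L)ᵀ * (rot * itinJac γ L * rotᵀ) = 1 := by
  rw [transpose_mul_rot_conj, det_itinJac, one_smul]

/-- The dual cocycle acts on rotated vectors as the rotation of the original action:
`(R M Rᵀ)(R τ) = R (M τ)` — conormal images are the rotated tangent images, with the same length. -/
theorem dual_mulVec_rot (M : Matrix (Fin 2) (Fin 2) ℝ) (τ : Fin 2 → ℝ) :
    (rot * M * rotᵀ) *ᵥ (rot *ᵥ τ) = rot *ᵥ (M *ᵥ τ) := by
  obtain ⟨h00, h01, h10, h11⟩ := rot_conj_apply M
  ext i; fin_cases i <;>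
    simp [Matrix.mulVec, dotProduct, Fin.sum_univ_two, h00, h01, h10, h11] <;> ring

/-- **Cone avoidance, material form.**  If `τ` lies in the tree's unstable cone `γ|τ₁| ≤ 2|τ₀|` (`γ² ≥ 8`), the image of the
rotated vector `R τ` under the DUAL cocycle of any sign itinerary has second component of size `≥ (γ²−3)^{|L|} |τ₀|` and stays in
the rotated cone: sheets born transverse to the next shear have conormals (wave-vectors) that expand at the cascade rate and
never visit the Orr-amplifying sector.  (Pure rewriting of `itinJac_growth_two`.) -/
theorem dual_cone_growth {γ : ℝ} (hγ : 0 < γ) (h8 : 8 ≤ γ ^ 2) {L : List (ℝ × ℝ)} (hL : IsSignList L)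
    {τ : Fin 2 → ℝ} (hτ : γ * |τ 1| ≤ 2 * |τ 0|) :
    (γ ^ 2 - 3) ^ L.length * |τ 0| ≤ |((rot * itinJac γ L * rotᵀ) *ᵥ (rot *ᵥ τ)) 1| ∧
      γ * |((rot * itinJac γ L * rotᵀ) *ᵥ (rot *ᵥ τ)) 0| ≤ 2 * |((rot * itinJac γ L * rotᵀ) *ᵥ (rot *ᵥ τ)) 1| := by
  have h := itinJac_growth_two hγ h8 hL hτ
  rw [dual_mulVec_rot, rot_mulVec_one, rot_mulVec_zero, abs_neg]
  exact ⟨h.2, h.1⟩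

end MaterialDual

section BudgetAlgebra

/-- **Weighted two-component slot step.**  If the transported ("old") and freshly created ("sheet") energies after a slot obey
`x' ≤ a x + b y`, `y' ≤ c x + d y` with non-negative data, then the weighted budget `x + θ y` (θ > 0) grows by at most `Λ` as soon
as `a + θ c ≤ Λ` and `b + θ d ≤ Λ θ` (column sums of the weighted transfer matrix).  Chaining two slots and reading `Λ_H Λ_V`
against the cap² is the per-phase material budget of memo §4; `weightedCocycle_energy_bound` then gives K2's shape. -/
theorem twoComponent_step {x y x' y' a b c d θ Λ : ℝ} (hx : 0 ≤ x) (hy : 0 ≤ y) (hθ : 0 < θ)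
    (h1 : x' ≤ a * x + b * y) (h2 : y' ≤ c * x + d * y) (hcol1 : a + θ * c ≤ Λ) (hcol2 : b + θ * d ≤ Λ * θ) :
    x' + θ * y' ≤ Λ * (x + θ * y) := by
  have e1 : (a + θ * c) * x ≤ Λ * x := mul_le_mul_of_nonneg_right hcol1 hx
  have e2 : (b + θ * d) * y ≤ Λ * θ * y := mul_le_mul_of_nonneg_right hcol2 hy
  have e3 : θ * y' ≤ θ * (c * x + d * y) := mul_le_mul_of_nonneg_left h2 hθ.le
  nlinarith [e1, e2, e3, h1]

/-- Two slots compose: factors `Λ₁` then `Λ₂` (same weight) give the phase factor `Λ₁ Λ₂` on the weighted budget. -/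
theorem twoSlot_phase {N₀ N₁ N₂ Λ₁ Λ₂ : ℝ} (hΛ₂ : 0 ≤ Λ₂) (h1 : N₁ ≤ Λ₁ * N₀) (h2 : N₂ ≤ Λ₂ * N₁) :
    N₂ ≤ (Λ₁ * Λ₂) * N₀ := by
  have : Λ₂ * N₁ ≤ Λ₂ * (Λ₁ * N₀) := mul_le_mul_of_nonneg_left h1 hΛ₂
  linarith [this]

/-- **Two-generation recursion ⇒ per-phase factor** (memo `K2MaterialControl.md` §3).  Let `a s ≥ 0` be the amplitude
(√energy) of the fresh sheet generation created in slot `s`, and suppose the creation recursion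
`a (s+2) ≤ p (s+1) · a (s+1) + r · a s` (the fresh pair is forced by the last generation with slot constant `p`, and by the
last-but-one with the lag constant `r`), where every slot constant is `≤ P` and CONSECUTIVE slot constants obey the phase
budget `p (s+1) · p s ≤ B` (one strong slot per phase).  Then the two-generation envelope `max (a (s+1)) (a s)` grows over
one phase (= two slots) by at most `Λ = max (B + r (P + 1)) (P + r)`.  With the measured sharp-model values
(B ≈ 15, P ≈ 14.7, r small) this is ≈ 20 against the cap 59.62; the point of the lemma is WHERE each constant enters. -/
theorem twoGeneration_phase {a p : ℕ → ℝ} {r B P : ℝ} (ha : ∀ s, 0 ≤ a s) (hp : ∀ s, 0 ≤ p s) (hr : 0 ≤ r)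
    (hP : ∀ s, p s ≤ P) (hB : ∀ s, p (s + 1) * p s ≤ B)
    (rec : ∀ s, a (s + 2) ≤ p (s + 1) * a (s + 1) + r * a s) (s : ℕ) :
    max (a (s + 3)) (a (s + 2)) ≤ max (B + r * (P + 1)) (P + r) * max (a (s + 1)) (a s) := by
  set M := max (a (s + 1)) (a s) with hM
  have hM0 : 0 ≤ M := le_trans (ha s) (le_max_right _ _)
  have h1 : a (s + 1) ≤ M := le_max_left _ _
  have h0 : a s ≤ M := le_max_right _ _
  -- slot s+2
  have e2 : a (s + 2) ≤ (p (s + 1) + r) * M := by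
    have := rec s
    have u1 : p (s + 1) * a (s + 1) ≤ p (s + 1) * M := mul_le_mul_of_nonneg_left h1 (hp _)
    have u2 : r * a s ≤ r * M := mul_le_mul_of_nonneg_left h0 hr
    nlinarith
  have e2' : a (s + 2) ≤ (P + r) * M := by
    have : (p (s + 1) + r) * M ≤ (P + r) * M := mul_le_mul_of_nonneg_right (by linarith [hP (s + 1)]) hM0
    linarith
  -- slot s+3
  have e3 : a (s + 3) ≤ (B + r * (P + 1)) * M := by
    have R := rec (s + 1)
    have v1 : p (s + 2) * a (s + 2) ≤ p (s + 2) * (p (s + 1) * a (s + 1) + r * a s) :=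
      mul_le_mul_of_nonneg_left (rec s) (hp _)
    have v2 : p (s + 2) * p (s + 1) * a (s + 1) ≤ B * M := by
      have := mul_le_mul (hB (s + 1)) h1 (ha _) (le_trans (mul_nonneg (hp _) (hp _)) (hB (s + 1)))
      simpa [mul_assoc] using this
    have v3 : p (s + 2) * (r * a s) ≤ P * (r * M) :=
      mul_le_mul (hP (s + 2)) (mul_le_mul_of_nonneg_left h0 hr) (mul_nonneg hr (ha s)) (le_trans (hp (s + 2)) (hP (s + 2)))
    have v4 : r * a (s + 1) ≤ r * M := mul_le_mul_of_nonneg_left h1 hr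
    nlinarith
  -- envelope
  have hΛ2 : (P + r) * M ≤ max (B + r * (P + 1)) (P + r) * M := mul_le_mul_of_nonneg_right (le_max_right _ _) hM0
  have hΛ3 : (B + r * (P + 1)) * M ≤ max (B + r * (P + 1)) (P + r) * M := mul_le_mul_of_nonneg_right (le_max_left _ _) hM0
  exact max_le (le_trans e3 hΛ3) (le_trans e2' hΛ2)

/-- Iterating `twoGeneration_phase`: the two-generation envelope after `j` phases is at most `Λ^j` times the initial one —
the shape of `K2PhaseGrowthClassicalH` (per-phase factor `Λ` in amplitude, to be compared with `C·e^{σ⋆γ}`). -/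
theorem twoGeneration_envelope {a p : ℕ → ℝ} {r B P : ℝ} (ha : ∀ s, 0 ≤ a s) (hp : ∀ s, 0 ≤ p s) (hr : 0 ≤ r)
    (hP : ∀ s, p s ≤ P) (hB : ∀ s, p (s + 1) * p s ≤ B)
    (rec : ∀ s, a (s + 2) ≤ p (s + 1) * a (s + 1) + r * a s) :
    ∀ j : ℕ, max (a (2 * j + 1)) (a (2 * j)) ≤ (max (B + r * (P + 1)) (P + r)) ^ j * max (a 1) (a 0) := by
  intro j
  induction j with
  | zero => simp
  | succ j ih =>
    have step := twoGeneration_phase ha hp hr hP hB rec (2 * j)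
    have hΛ : 0 ≤ max (B + r * (P + 1)) (P + r) :=
      le_trans (by nlinarith [hp 0, hP 0, hr] : (0:ℝ) ≤ P + r) (le_max_right _ _)
    have e1 : 2 * (j + 1) + 1 = 2 * j + 3 := by ring
    have e0 : 2 * (j + 1) = 2 * j + 2 := by ring
    rw [e1, e0, pow_succ]
    calc max (a (2 * j + 3)) (a (2 * j + 2))
        ≤ max (B + r * (P + 1)) (P + r) * max (a (2 * j + 1)) (a (2 * j)) := step
      _ ≤ max (B + r * (P + 1)) (P + r) * ((max (B + r * (P + 1)) (P + r)) ^ j * max (a 1) (a 0)) :=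
          mul_le_mul_of_nonneg_left ih hΛ
      _ = (max (B + r * (P + 1)) (P + r)) ^ j * max (B + r * (P + 1)) (P + r) * max (a 1) (a 0) := by ring

end BudgetAlgebra

end Summit.AnomalousDissipation.AnomalousDissipation.Cruxes.K1LocalisedCascade.K2Control
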